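import Summits.HodgeConjecture.CorCM.Census.CyclicCharacterEvenTies

/-!
# Cyclic characters, XXV: EVEN KERNEL — the even equator relations `R(C)`, `R(C ∪ u)` and `ζ` from the ascending tie face and the even three-across face

COR-CM (cell `pub-hodgecm2`), count-neutral kernel combinatorics by the binder seat b09 (gen 43; lane CYCLIC-CHARACTER FIBRE LAW, part XXV), on parts XVII, XVIII,
XIXa (the odd equator relations, whose bookkeeping is reused verbatim) and XXIV BY NAME.  Theorems only (no definition, no `decide`, no certificate, no named
fact, no `sorry`).  HONEST FRAMING: `HC_CM` is NOT proved, here or anywhere in the tree; nothing here is a period or a headline.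

SETTING: `|F_0| = 2m` even, `C ⊆ F_0` with `|C| = m`, the tie `X_C` (`T_0 ∖ X_C = C`), `ε_s = [T_0^{(s)}] − [T_0]`, `η_s = [T_1^{(s)}] − [T_1]`,
`R(X) = [T_0] − [T_1] + Σ_{s ∈ X} ε_s − Σ_{s ∈ F_0 ∖ X} η_s` (part XIXa), `ζ_s = ε_s + η_s` (part XIX).  A tie linearised toward `T_0` is «down», toward `T_1` «up»
(part XXIV: these are the only two possibilities, and the coverʼs own face at the tie decides).

* §1 **THE ASCENDING TIE FACE** (`rel_of_tieAscending`): if `X_C` is down (hypothesis `eX`) and `L` contains `gface X_C u u'` (`u ≠ u' ∈ F_0 ∖ C`), whose three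
  other corners are strictly nearer to `T_1`, then `R(C) ∈ L` — the bookkeeping of part XIXaʼs three-across relation.
* §2 **THE EVEN THREE-ACROSS FACE** at `X_{C ∖ b}` with places `b ∈ C`, `t ∉ C`: corners `X_{C∖b}` (near `T_0`), `X_{C ∪ t}` (near `T_1`) and the two ties
  `X_C`, `X_{C ∖ b ∪ t}`.  With `X_C` down: if `X_{C∖b∪t}` is down the face yields `R(C ∪ t) ∈ L` (`rel_of_threeAcross_even`, part XIXaʼs one-across bookkeeping);
  if it is up the face yields `ζ_b ∈ L` outright (`zeta_mem_of_threeAcross_even_up`).  Either way part XIXʼs pipeline (`zeta_mem_of_rels`, `fib_mem_of_rel`,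
  `shift_mem_of_zeta_mem`) runs — part XXVI.

## References
* [Pohlmann1968] H. Pohlmann, Algebraic cycles on abelian varieties of complex multiplication type, Ann. of Math. 88 (1968), Thm 1.
* [Milne1999] J. S. Milne, Lefschetz motives and the Tate conjecture, Compositio Math. 117 (1999), Prop. 2.1, p. 54.
-/

namespace Summit.HodgeConjecture.CorCM.Census.CyclicCharacter

open Finset
open Summit.HodgeConjecture.CorCM.Prior.AllgGroup.RfwfAllgGroup
open Summit.HodgeConjecture.CorCM.Census.BlockParity
open Summit.HodgeConjecture.CorCM.Census.Coinvariant
open Summit.HodgeConjecture.CorCM.Census.TwistGeneration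
open Summit.HodgeConjecture.CorCM.Census.Nondegenerate
open Summit.HodgeConjecture.CorCM.Census.BaseBlock

noncomputable section

variable {G : Type*} [Group G] [Fintype G] [DecidableEq G] {k : ℕ} {w : G → ZMod (2 ^ k)} {c : G}

/-! ## §1 The ascending tie face gives `R(C)` -/

/-- **THE ASCENDING TIE RELATION.**  `L` with the toward property, `T_0 ∖ X = B' ⊆ F_0` with `2(|F_0| − |B'| − 1) < |F_0|`, `t ≠ t' ∈ F_0 ∖ B'`, the face
`gface X t t'` in `L`, and `X` linearised toward `T_0` in `L` (`eX`; at a tie this is what an explicit downward face gives, part XXIV).  Then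
`R(B') = [T_0] − [T_1] + Σ_{s ∈ B'} ε_s − Σ_{s ∈ F_0∖B'} η_s ∈ L`. [folklore] -/
theorem rel_of_tieAscending (hw : ∀ P Q : G, w (P * Q) = w P + w Q) (hk : 1 ≤ k) (hc2 : c * c = 1) (hwc : w c ≠ 0)
    (h1 : ∃ g₁ : G, w g₁ = 1) (L : Submodule ℤ (CMF G c →₀ ℤ))
    (htw : ∀ Φ : CMF G c, 2 ≤ bpot c (arcType hw hk hc2 hwc 0) Φ → ∃ Q t t' : G,
      bpot c (arcType hw hk hc2 hwc 0) Φ = ddist (rt c Q (arcType hw hk hc2 hwc 0)) Φ ∧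
        t ∈ (rt c Q (arcType hw hk hc2 hwc 0)).1 \ Φ.1 ∧ t' ∈ (rt c Q (arcType hw hk hc2 hwc 0)).1 \ Φ.1 ∧ t ≠ t' ∧ gface c hc2 Φ t t' ∈ L)
    {X : CMF G c} {B' : Finset G} (hX : (arcType hw hk hc2 hwc 0).1 \ X.1 = B') (hB' : B' ⊆ univ.filter fun s => w s = 0)
    (hlarge : 2 * ((univ.filter fun s : G => w s = 0).card - B'.card - 1) < (univ.filter fun s : G => w s = 0).card)
    {t t' : G} (ht : w t = 0) (ht' : w t' = 0) (htB : t ∉ B') (ht'B : t' ∉ B') (htt' : t ≠ t') (hf : gface c hc2 X t t' ∈ L)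
    (eX : Finsupp.single X (1 : ℤ) - ((∑ s ∈ (arcType hw hk hc2 hwc 0).1 \ X.1,
      (Finsupp.single (oflipCM c hc2 s (arcType hw hk hc2 hwc 0)) (1 : ℤ) - Finsupp.single (arcType hw hk hc2 hwc 0) 1)) +
        Finsupp.single (arcType hw hk hc2 hwc 0) 1) ∈ L) :
    Finsupp.single (arcType hw hk hc2 hwc 0) (1 : ℤ) - Finsupp.single (arcType hw hk hc2 hwc 1) 1 +
      (∑ s ∈ B', (Finsupp.single (oflipCM c hc2 s (arcType hw hk hc2 hwc 0)) (1 : ℤ) - Finsupp.single (arcType hw hk hc2 hwc 0) 1)) -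
      (∑ s ∈ (univ.filter fun s => w s = 0) \ B',
        (Finsupp.single (oflipCM c hc2 s (arcType hw hk hc2 hwc 1)) (1 : ℤ) - Finsupp.single (arcType hw hk hc2 hwc 1) 1)) ∈ L := by
  obtain ⟨Qm, hQm⟩ := exists_apply_eq hw h1 (-1)
  have eT₁ : arcType hw hk hc2 hwc 1 = rt c Qm (arcType hw hk hc2 hwc 0) := arcType_eq_rt hw hk hc2 hwc hQm
  have htF : t ∈ univ.filter (fun s : G => w s = 0) := mem_filter.mpr ⟨mem_univ _, ht⟩
  have ht'F : t' ∈ univ.filter (fun s : G => w s = 0) := mem_filter.mpr ⟨mem_univ _, ht'⟩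
  -- deviation sets of the four corners
  have hXt : (arcType hw hk hc2 hwc 0).1 \ (oflipCM c hc2 t X).1 = insert t B' := sdiff_oflipCM_eq_insert hw hk hc2 hwc hX ht htB
  have hXt' : (arcType hw hk hc2 hwc 0).1 \ (oflipCM c hc2 t' X).1 = insert t' B' := sdiff_oflipCM_eq_insert hw hk hc2 hwc hX ht' ht'B
  have hXtt' : (arcType hw hk hc2 hwc 0).1 \ (oflipCM c hc2 t (oflipCM c hc2 t' X)).1 = insert t (insert t' B') :=
    sdiff_oflipCM_eq_insert hw hk hc2 hwc hXt' ht (by rw [mem_insert]; push Not; exact ⟨htt', htB⟩)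
  have hBt : insert t B' ⊆ univ.filter fun s : G => w s = 0 := insert_subset htF hB'
  have hBt' : insert t' B' ⊆ univ.filter fun s : G => w s = 0 := insert_subset ht'F hB'
  have hBtt' : insert t (insert t' B') ⊆ univ.filter fun s : G => w s = 0 := insert_subset htF hBt'
  have hct : (insert t B').card = B'.card + 1 := card_insert_of_notMem htB
  have hct' : (insert t' B').card = B'.card + 1 := card_insert_of_notMem ht'B
  have hctt' : (insert t (insert t' B')).card = B'.card + 2 := by
    rw [card_insert_of_notMem (by rw [mem_insert]; push Not; exact ⟨htt', htB⟩), hct']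
  -- the three upper corners are within half a fibre of `T_1`
  have h₂ : 2 * ddist (rt c Qm (arcType hw hk hc2 hwc 0)) (oflipCM c hc2 t (oflipCM c hc2 t' X)) < (univ.filter fun s : G => w s = 0).card := by
    rw [← eT₁, ddist_arcType_one_eq hw hk hc2 hwc hXtt' hBtt', hctt']; omega
  have h₃ : 2 * ddist (rt c Qm (arcType hw hk hc2 hwc 0)) (oflipCM c hc2 t X) < (univ.filter fun s : G => w s = 0).card := by
    rw [← eT₁, ddist_arcType_one_eq hw hk hc2 hwc hXt hBt, hct]; omega
  have h₄ : 2 * ddist (rt c Qm (arcType hw hk hc2 hwc 0)) (oflipCM c hc2 t' X) < (univ.filter fun s : G => w s = 0).card := by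
    rw [← eT₁, ddist_arcType_one_eq hw hk hc2 hwc hXt' hBt', hct']; omega
  have e₁ : Finsupp.single X (1 : ℤ) - ((∑ s ∈ (rt c 1 (arcType hw hk hc2 hwc 0)).1 \ X.1,
      (Finsupp.single (oflipCM c hc2 s (rt c 1 (arcType hw hk hc2 hwc 0))) (1 : ℤ) - Finsupp.single (rt c 1 (arcType hw hk hc2 hwc 0)) 1)) +
        Finsupp.single (rt c 1 (arcType hw hk hc2 hwc 0)) 1) ∈ L := by rw [rt_one]; exact eX
  have e₂ := single_sub_normalForm_mem_of_toward hw hk hc2 hwc L htw Qm _ h₂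
  have e₃ := single_sub_normalForm_mem_of_toward hw hk hc2 hwc L htw Qm _ h₃
  have e₄ := single_sub_normalForm_mem_of_toward hw hk hc2 hwc L htw Qm _ h₄
  have hrel := alt_normalForm_mem_of_mems hw hk hc2 hwc L hf 1 Qm Qm Qm e₁ e₂ e₃ e₄
  rw [rt_one, ← eT₁, hX, normalForm_one_eq hw hk hc2 hwc _ (hXtt'.symm ▸ hBtt'), normalForm_one_eq hw hk hc2 hwc _ (hXt.symm ▸ hBt),
    normalForm_one_eq hw hk hc2 hwc _ (hXt'.symm ▸ hBt'), hXtt', hXt, hXt'] at hrel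
  -- bookkeeping over `U = F_0 ∖ B'` (verbatim part XIXa)
  have hU : t ∈ (univ.filter fun s : G => w s = 0) \ B' := mem_sdiff.mpr ⟨htF, htB⟩
  have hU' : t' ∈ (univ.filter fun s : G => w s = 0) \ B' := mem_sdiff.mpr ⟨ht'F, ht'B⟩
  simp only [sdiff_insert] at hrel
  set H : G → (CMF G c →₀ ℤ) := fun s =>
    Finsupp.single (oflipCM c hc2 s (arcType hw hk hc2 hwc 1)) (1 : ℤ) - Finsupp.single (arcType hw hk hc2 hwc 1) 1 with hH
  set U := (univ.filter fun s : G => w s = 0) \ B' with hUdef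
  have e1 : (∑ s ∈ U.erase t, H s) = H t' + ∑ s ∈ (U.erase t').erase t, H s := by
    rw [← add_sum_erase _ _ (mem_erase.mpr ⟨htt'.symm, hU'⟩), erase_right_comm]
  have e2 : (∑ s ∈ U.erase t', H s) = H t + ∑ s ∈ (U.erase t').erase t, H s := by
    rw [← add_sum_erase _ _ (mem_erase.mpr ⟨htt', hU⟩)]
  have e3 : (∑ s ∈ U, H s) = H t + (H t' + ∑ s ∈ (U.erase t').erase t, H s) := by
    rw [← add_sum_erase _ _ hU, e1]
  rw [e1, e2] at hrel
  rw [e3]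
  convert hrel using 1
  abel

/-! ## §2 The even three-across face: `R(C ∪ t)` (second tie down) or `ζ_b` (second tie up) -/

/-- **THE EVEN THREE-ACROSS RELATION, second tie down.**  `L` with the toward property; `T_0 ∖ X = B' ∖ b` (`b ∈ B' ⊆ F_0`) with `2(|B'| − 1) < |F_0|` and
`2(|F_0| − |B'| − 1) < |F_0|`; `t ∈ F_0 ∖ B'`; the face `gface X b t` in `L`; the two tie corners `X^{(b)}` (deviation `B'`) and `X^{(t)}` (deviation
`B' ∖ b ∪ t`) linearised toward `T_0` in `L`.  Then `R(B' ∪ t) ∈ L`: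
`[T_0] − [T_1] + Σ_{s ∈ B'} ε_s + ε_t − Σ_{s ∈ F_0∖B'∖t} η_s ∈ L`. [folklore] -/
theorem rel_of_threeAcross_even (hw : ∀ P Q : G, w (P * Q) = w P + w Q) (hk : 1 ≤ k) (hc2 : c * c = 1) (hwc : w c ≠ 0)
    (h1 : ∃ g₁ : G, w g₁ = 1) (L : Submodule ℤ (CMF G c →₀ ℤ))
    (htw : ∀ Φ : CMF G c, 2 ≤ bpot c (arcType hw hk hc2 hwc 0) Φ → ∃ Q t t' : G,
      bpot c (arcType hw hk hc2 hwc 0) Φ = ddist (rt c Q (arcType hw hk hc2 hwc 0)) Φ ∧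
        t ∈ (rt c Q (arcType hw hk hc2 hwc 0)).1 \ Φ.1 ∧ t' ∈ (rt c Q (arcType hw hk hc2 hwc 0)).1 \ Φ.1 ∧ t ≠ t' ∧ gface c hc2 Φ t t' ∈ L)
    {X : CMF G c} {B' : Finset G} {b : G} (hb : b ∈ B') (hX : (arcType hw hk hc2 hwc 0).1 \ X.1 = B'.erase b)
    (hB' : B' ⊆ univ.filter fun s => w s = 0)
    (hsmall : 2 * (B'.card - 1) < (univ.filter fun s : G => w s = 0).card)
    (hlarge : 2 * ((univ.filter fun s : G => w s = 0).card - B'.card - 1) < (univ.filter fun s : G => w s = 0).card)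
    {t : G} (ht : w t = 0) (htB : t ∉ B') (hf : gface c hc2 X b t ∈ L)
    (eb : Finsupp.single (oflipCM c hc2 b X) (1 : ℤ) - ((∑ s ∈ (arcType hw hk hc2 hwc 0).1 \ (oflipCM c hc2 b X).1,
      (Finsupp.single (oflipCM c hc2 s (arcType hw hk hc2 hwc 0)) (1 : ℤ) - Finsupp.single (arcType hw hk hc2 hwc 0) 1)) +
        Finsupp.single (arcType hw hk hc2 hwc 0) 1) ∈ L)
    (et : Finsupp.single (oflipCM c hc2 t X) (1 : ℤ) - ((∑ s ∈ (arcType hw hk hc2 hwc 0).1 \ (oflipCM c hc2 t X).1,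
      (Finsupp.single (oflipCM c hc2 s (arcType hw hk hc2 hwc 0)) (1 : ℤ) - Finsupp.single (arcType hw hk hc2 hwc 0) 1)) +
        Finsupp.single (arcType hw hk hc2 hwc 0) 1) ∈ L) :
    Finsupp.single (arcType hw hk hc2 hwc 0) (1 : ℤ) - Finsupp.single (arcType hw hk hc2 hwc 1) 1 +
      (∑ s ∈ B', (Finsupp.single (oflipCM c hc2 s (arcType hw hk hc2 hwc 0)) (1 : ℤ) - Finsupp.single (arcType hw hk hc2 hwc 0) 1)) +
      (Finsupp.single (oflipCM c hc2 t (arcType hw hk hc2 hwc 0)) (1 : ℤ) - Finsupp.single (arcType hw hk hc2 hwc 0) 1) -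
      (∑ s ∈ ((univ.filter fun s => w s = 0) \ B').erase t,
        (Finsupp.single (oflipCM c hc2 s (arcType hw hk hc2 hwc 1)) (1 : ℤ) - Finsupp.single (arcType hw hk hc2 hwc 1) 1)) ∈ L := by
  obtain ⟨Qm, hQm⟩ := exists_apply_eq hw h1 (-1)
  have eT₁ : arcType hw hk hc2 hwc 1 = rt c Qm (arcType hw hk hc2 hwc 0) := arcType_eq_rt hw hk hc2 hwc hQm
  have hb0 : w b = 0 := (mem_filter.mp (hB' hb)).2
  have htF : t ∈ univ.filter (fun s : G => w s = 0) := mem_filter.mpr ⟨mem_univ _, ht⟩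
  have hbt : b ≠ t := fun h => htB (h ▸ hb)
  -- deviation sets of the four corners
  have hXb : (arcType hw hk hc2 hwc 0).1 \ (oflipCM c hc2 b X).1 = B' := by
    rw [sdiff_oflipCM_eq_insert hw hk hc2 hwc hX hb0 (notMem_erase b B'), insert_erase hb]
  have hXt : (arcType hw hk hc2 hwc 0).1 \ (oflipCM c hc2 t X).1 = insert t (B'.erase b) :=
    sdiff_oflipCM_eq_insert hw hk hc2 hwc hX ht (fun h => htB (mem_of_mem_erase h))
  have hXbt : (arcType hw hk hc2 hwc 0).1 \ (oflipCM c hc2 b (oflipCM c hc2 t X)).1 = insert t B' := by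
    rw [sdiff_oflipCM_eq_insert hw hk hc2 hwc hXt hb0 (by rw [mem_insert]; push Not; exact ⟨hbt, notMem_erase b B'⟩),
      Finset.insert_comm, insert_erase hb]
  have hBt : insert t B' ⊆ univ.filter fun s : G => w s = 0 := insert_subset htF hB'
  have hBte : insert t (B'.erase b) ⊆ univ.filter fun s : G => w s = 0 := insert_subset htF ((erase_subset b B').trans hB')
  have hce : (B'.erase b).card + 1 = B'.card := card_erase_add_one hb
  have hct : (insert t B').card = B'.card + 1 := card_insert_of_notMem htB
  -- distances: `X` near `T_0`, `X^{(b)(t)}` near `T_1`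
  have h₁ : 2 * ddist (rt c 1 (arcType hw hk hc2 hwc 0)) X < (univ.filter fun s : G => w s = 0).card := by
    rw [rt_one]; unfold ddist; rw [hX]; omega
  have h₂ : 2 * ddist (rt c Qm (arcType hw hk hc2 hwc 0)) (oflipCM c hc2 b (oflipCM c hc2 t X)) < (univ.filter fun s : G => w s = 0).card := by
    rw [← eT₁, ddist_arcType_one_eq hw hk hc2 hwc hXbt hBt, hct]; omega
  have e₁ := single_sub_normalForm_mem_of_toward hw hk hc2 hwc L htw 1 X h₁
  have e₂ := single_sub_normalForm_mem_of_toward hw hk hc2 hwc L htw Qm _ h₂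
  have e₃ : Finsupp.single (oflipCM c hc2 b X) (1 : ℤ) - ((∑ s ∈ (rt c 1 (arcType hw hk hc2 hwc 0)).1 \ (oflipCM c hc2 b X).1,
      (Finsupp.single (oflipCM c hc2 s (rt c 1 (arcType hw hk hc2 hwc 0))) (1 : ℤ) - Finsupp.single (rt c 1 (arcType hw hk hc2 hwc 0)) 1)) +
        Finsupp.single (rt c 1 (arcType hw hk hc2 hwc 0)) 1) ∈ L := by rw [rt_one]; exact eb
  have e₄ : Finsupp.single (oflipCM c hc2 t X) (1 : ℤ) - ((∑ s ∈ (rt c 1 (arcType hw hk hc2 hwc 0)).1 \ (oflipCM c hc2 t X).1,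
      (Finsupp.single (oflipCM c hc2 s (rt c 1 (arcType hw hk hc2 hwc 0))) (1 : ℤ) - Finsupp.single (rt c 1 (arcType hw hk hc2 hwc 0)) 1)) +
        Finsupp.single (rt c 1 (arcType hw hk hc2 hwc 0)) 1) ∈ L := by rw [rt_one]; exact et
  have hrel := alt_normalForm_mem_of_mems hw hk hc2 hwc L hf 1 Qm 1 1 e₁ e₂ e₃ e₄
  rw [rt_one, ← eT₁, hX, hXb, hXt, normalForm_one_eq hw hk hc2 hwc _ (hXbt.symm ▸ hBt), hXbt, sdiff_insert,
    sum_insert (fun h => htB (mem_of_mem_erase h))] at hrel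
  set E : G → (CMF G c →₀ ℤ) := fun s =>
    Finsupp.single (oflipCM c hc2 s (arcType hw hk hc2 hwc 0)) (1 : ℤ) - Finsupp.single (arcType hw hk hc2 hwc 0) 1 with hE
  have e1 : (∑ s ∈ B', E s) = E b + ∑ s ∈ B'.erase b, E s := (add_sum_erase B' E hb).symm
  rw [e1] at hrel ⊢
  rw [← Submodule.neg_mem_iff]
  convert hrel using 1
  abel

/-- **THE EVEN THREE-ACROSS FACE, second tie up, gives `ζ_b` outright.**  Same face as `rel_of_threeAcross_even`, but the tie corner `X^{(t)}` (deviation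
`B' ∖ b ∪ t`) linearised toward `T_1` in `L`.  Then `ζ_b = ε_b + η_b ∈ L`. [folklore] -/
theorem zeta_mem_of_threeAcross_even_up (hw : ∀ P Q : G, w (P * Q) = w P + w Q) (hk : 1 ≤ k) (hc2 : c * c = 1) (hwc : w c ≠ 0)
    (h1 : ∃ g₁ : G, w g₁ = 1) (L : Submodule ℤ (CMF G c →₀ ℤ))
    (htw : ∀ Φ : CMF G c, 2 ≤ bpot c (arcType hw hk hc2 hwc 0) Φ → ∃ Q t t' : G,
      bpot c (arcType hw hk hc2 hwc 0) Φ = ddist (rt c Q (arcType hw hk hc2 hwc 0)) Φ ∧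
        t ∈ (rt c Q (arcType hw hk hc2 hwc 0)).1 \ Φ.1 ∧ t' ∈ (rt c Q (arcType hw hk hc2 hwc 0)).1 \ Φ.1 ∧ t ≠ t' ∧ gface c hc2 Φ t t' ∈ L)
    {X : CMF G c} {B' : Finset G} {b : G} (hb : b ∈ B') (hX : (arcType hw hk hc2 hwc 0).1 \ X.1 = B'.erase b)
    (hB' : B' ⊆ univ.filter fun s => w s = 0)
    (hsmall : 2 * (B'.card - 1) < (univ.filter fun s : G => w s = 0).card)
    (hlarge : 2 * ((univ.filter fun s : G => w s = 0).card - B'.card - 1) < (univ.filter fun s : G => w s = 0).card)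
    {t : G} (ht : w t = 0) (htB : t ∉ B') (hf : gface c hc2 X b t ∈ L)
    (eb : Finsupp.single (oflipCM c hc2 b X) (1 : ℤ) - ((∑ s ∈ (arcType hw hk hc2 hwc 0).1 \ (oflipCM c hc2 b X).1,
      (Finsupp.single (oflipCM c hc2 s (arcType hw hk hc2 hwc 0)) (1 : ℤ) - Finsupp.single (arcType hw hk hc2 hwc 0) 1)) +
        Finsupp.single (arcType hw hk hc2 hwc 0) 1) ∈ L)
    (et : Finsupp.single (oflipCM c hc2 t X) (1 : ℤ) - ((∑ s ∈ (arcType hw hk hc2 hwc 1).1 \ (oflipCM c hc2 t X).1,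
      (Finsupp.single (oflipCM c hc2 s (arcType hw hk hc2 hwc 1)) (1 : ℤ) - Finsupp.single (arcType hw hk hc2 hwc 1) 1)) +
        Finsupp.single (arcType hw hk hc2 hwc 1) 1) ∈ L) :
    (Finsupp.single (oflipCM c hc2 b (arcType hw hk hc2 hwc 0)) (1 : ℤ) - Finsupp.single (arcType hw hk hc2 hwc 0) 1) +
      (Finsupp.single (oflipCM c hc2 b (arcType hw hk hc2 hwc 1)) (1 : ℤ) - Finsupp.single (arcType hw hk hc2 hwc 1) 1) ∈ L := by
  obtain ⟨Qm, hQm⟩ := exists_apply_eq hw h1 (-1)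
  have eT₁ : arcType hw hk hc2 hwc 1 = rt c Qm (arcType hw hk hc2 hwc 0) := arcType_eq_rt hw hk hc2 hwc hQm
  have hb0 : w b = 0 := (mem_filter.mp (hB' hb)).2
  have hbF : b ∈ univ.filter (fun s : G => w s = 0) := hB' hb
  have htF : t ∈ univ.filter (fun s : G => w s = 0) := mem_filter.mpr ⟨mem_univ _, ht⟩
  have hbt : b ≠ t := fun h => htB (h ▸ hb)
  -- deviation sets of the four corners
  have hXb : (arcType hw hk hc2 hwc 0).1 \ (oflipCM c hc2 b X).1 = B' := by
    rw [sdiff_oflipCM_eq_insert hw hk hc2 hwc hX hb0 (notMem_erase b B'), insert_erase hb]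
  have hXt : (arcType hw hk hc2 hwc 0).1 \ (oflipCM c hc2 t X).1 = insert t (B'.erase b) :=
    sdiff_oflipCM_eq_insert hw hk hc2 hwc hX ht (fun h => htB (mem_of_mem_erase h))
  have hXbt : (arcType hw hk hc2 hwc 0).1 \ (oflipCM c hc2 b (oflipCM c hc2 t X)).1 = insert t B' := by
    rw [sdiff_oflipCM_eq_insert hw hk hc2 hwc hXt hb0 (by rw [mem_insert]; push Not; exact ⟨hbt, notMem_erase b B'⟩),
      Finset.insert_comm, insert_erase hb]
  have hBt : insert t B' ⊆ univ.filter fun s : G => w s = 0 := insert_subset htF hB'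
  have hBte : insert t (B'.erase b) ⊆ univ.filter fun s : G => w s = 0 := insert_subset htF ((erase_subset b B').trans hB')
  have hce : (B'.erase b).card + 1 = B'.card := card_erase_add_one hb
  have hct : (insert t B').card = B'.card + 1 := card_insert_of_notMem htB
  -- distances: `X` near `T_0`, `X^{(b)(t)}` near `T_1`
  have h₁ : 2 * ddist (rt c 1 (arcType hw hk hc2 hwc 0)) X < (univ.filter fun s : G => w s = 0).card := by
    rw [rt_one]; unfold ddist; rw [hX]; omega
  have h₂ : 2 * ddist (rt c Qm (arcType hw hk hc2 hwc 0)) (oflipCM c hc2 b (oflipCM c hc2 t X)) < (univ.filter fun s : G => w s = 0).card := by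
    rw [← eT₁, ddist_arcType_one_eq hw hk hc2 hwc hXbt hBt, hct]; omega
  have e₁ := single_sub_normalForm_mem_of_toward hw hk hc2 hwc L htw 1 X h₁
  have e₂ := single_sub_normalForm_mem_of_toward hw hk hc2 hwc L htw Qm _ h₂
  have e₃ : Finsupp.single (oflipCM c hc2 b X) (1 : ℤ) - ((∑ s ∈ (rt c 1 (arcType hw hk hc2 hwc 0)).1 \ (oflipCM c hc2 b X).1,
      (Finsupp.single (oflipCM c hc2 s (rt c 1 (arcType hw hk hc2 hwc 0))) (1 : ℤ) - Finsupp.single (rt c 1 (arcType hw hk hc2 hwc 0)) 1)) +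
        Finsupp.single (rt c 1 (arcType hw hk hc2 hwc 0)) 1) ∈ L := by rw [rt_one]; exact eb
  have e₄ : Finsupp.single (oflipCM c hc2 t X) (1 : ℤ) - ((∑ s ∈ (rt c Qm (arcType hw hk hc2 hwc 0)).1 \ (oflipCM c hc2 t X).1,
      (Finsupp.single (oflipCM c hc2 s (rt c Qm (arcType hw hk hc2 hwc 0))) (1 : ℤ) - Finsupp.single (rt c Qm (arcType hw hk hc2 hwc 0)) 1)) +
        Finsupp.single (rt c Qm (arcType hw hk hc2 hwc 0)) 1) ∈ L := by rw [← eT₁]; exact et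
  have hrel := alt_normalForm_mem_of_mems hw hk hc2 hwc L hf 1 Qm 1 Qm e₁ e₂ e₃ e₄
  rw [rt_one, ← eT₁, hX, hXb, normalForm_one_eq hw hk hc2 hwc _ (hXbt.symm ▸ hBt), normalForm_one_eq hw hk hc2 hwc _ (hXt.symm ▸ hBte), hXbt, hXt,
    sdiff_insert] at hrel
  -- `F_0 ∖ (B' ∖ b ∪ t) = {b} ∪ (F_0 ∖ B' ∖ t)`
  have hset : (univ.filter fun s : G => w s = 0) \ insert t (B'.erase b) = insert b (((univ.filter fun s : G => w s = 0) \ B').erase t) := by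
    ext x
    simp only [mem_sdiff, mem_insert, mem_erase, not_or, not_and]
    constructor
    · rintro ⟨hxF, hxt, hxB⟩
      by_cases hxb : x = b
      · exact Or.inl hxb
      · exact Or.inr ⟨hxt, hxF, hxB hxb⟩
    · rintro (rfl | ⟨hxt, hxF, hxB⟩)
      · exact ⟨hbF, hbt, fun h => absurd rfl h⟩
      · exact ⟨hxF, hxt, fun _ => hxB⟩
  rw [hset, sum_insert (fun h => (mem_sdiff.mp (mem_of_mem_erase h)).2 hb)] at hrel
  set E : G → (CMF G c →₀ ℤ) := fun s =>
    Finsupp.single (oflipCM c hc2 s (arcType hw hk hc2 hwc 0)) (1 : ℤ) - Finsupp.single (arcType hw hk hc2 hwc 0) 1 with hE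
  have e1 : (∑ s ∈ B', E s) = E b + ∑ s ∈ B'.erase b, E s := (add_sum_erase B' E hb).symm
  rw [e1] at hrel
  rw [← Submodule.neg_mem_iff]
  convert hrel using 1
  simp only [hE]
  abel

end

end Summit.HodgeConjecture.CorCM.Census.CyclicCharacter
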